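import Mathlib
import Summits.KontsevichZagierPeriods.KontsevichZagierPeriods.Theorems.SoloInformedLocusPieces
import Summits.KontsevichZagierPeriods.KontsevichZagierPeriods.Theorems.SoloInformedSideCases
import HarnessLib

/-!
# Solo-informed (A390-ii): integrability loci — the two sides of a prepared band

File F5b of the KERNEL LEMMA I programme; the locus counterpart of `SoloInformedSideCases`.  Over a
piece `P` of the base carrying the locus bundle `SoloInformedLocusHyp P a H₀ I c` (mass `H₀`
comparable with `|a| · I`, `I(w) = ∫_{(α, β)} s^r`), the locus `{t | ∫ 1_P H₀ (t, ·) < ∞}` is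
`ℚ`-semialgebraic, granted LEMMA I and the log-room theorem one dimension down: pieces NEAR / FAR
(surrogates), the logarithmic piece (`r = -1`), and the NULL pieces (`I = ⊤`: the null-fibre
locus of `{a ≠ 0}`), assembled for the half-line side (`soloInformed_locus_side_top`) and the
bounded side (`soloInformed_locus_side_fin`).
-/

open MeasureTheory Set Real
open scoped ENNReal
open Literature.ModelTheory.ExponentialFields Literature.NumberTheory.Transcendental

namespace Summit.KontsevichZagierPeriods.KontsevichZagierPeriods.Theorems

variable {k m : ℕ} {P : Set (Fin (k + m) → ℝ)} {a α b : (Fin (k + m) → ℝ) → ℝ}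
  {H₀ I : (Fin (k + m) → ℝ) → ℝ≥0∞} {c : ℝ}

/-! ### Individual pieces -/

/-- NEAR piece `{0 < α < b ≤ 2α}`: surrogate `S = α^r (b − α)`. -/
theorem soloInformed_locus_near (ihI : SoloInformedFinLocusAt k m)
    (h : SoloInformedLocusHyp P a H₀ I c) (hα : IsSemialgebraicFunOn ℚ P α)
    (hb : IsSemialgebraicFunOn ℚ P b) (r : ℚ)
    (hP : ∀ w ∈ P, 0 < α w ∧ α w < b w ∧ b w ≤ 2 * α w ∧
      I w = ∫⁻ s in soloInformedEIoo (α w : EReal) (b w : EReal), ENNReal.ofReal (s ^ (r : ℝ))) :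
    IsSemialgebraic ℚ {t : Fin k → ℝ | ∫⁻ x, P.indicator H₀ (Fin.append t x) < ∞} := by
  have hS : IsSemialgebraicFunOn ℚ P (fun w => α w ^ ((r : ℚ) : ℝ) * (b w - α w)) :=
    (IsSemialgebraicFunOn.mul_holds (hα.rpow_ratCast h.sa_P (fun w hw => (hP w hw).1) r)
      (IsSemialgebraicFunOn.sub_holds hb hα)).congr fun _ _ => rfl
  refine soloInformed_locus_surrogate ihI h hS (fun w hw => ?_) (T := (2 : ℝ) ^ |(r : ℝ)|)
    (L := (2 : ℝ) ^ (-|(r : ℝ)|)) (by positivity) (by positivity) (fun w hw => ?_)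
    (fun w hw => ?_)
  · obtain ⟨h0, h1, -, -⟩ := hP w hw
    exact mul_nonneg (rpow_nonneg h0.le _) (by linarith)
  · obtain ⟨h0, -, h2, hI⟩ := hP w hw
    rw [hI, show (2 : ℝ) ^ |(r : ℝ)| * (α w ^ ((r : ℚ) : ℝ) * (b w - α w)) =
      (2 : ℝ) ^ |(r : ℝ)| * α w ^ ((r : ℚ) : ℝ) * (b w - α w) by ring]
    exact (soloInformed_Irp_near_bounds (r : ℝ) h0 h2).2
  · obtain ⟨h0, -, h2, hI⟩ := hP w hw
    rw [hI, show (2 : ℝ) ^ (-|(r : ℝ)|) * (α w ^ ((r : ℚ) : ℝ) * (b w - α w)) =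
      (2 : ℝ) ^ (-|(r : ℝ)|) * α w ^ ((r : ℚ) : ℝ) * (b w - α w) by ring]
    exact (soloInformed_Irp_near_bounds (r : ℝ) h0 h2).1

/-- FAR piece `{0 ≤ α, 2α < b}` for `r > -1`: surrogate `S = b^r b`. -/
theorem soloInformed_locus_far_pos (ihI : SoloInformedFinLocusAt k m)
    (h : SoloInformedLocusHyp P a H₀ I c) (hb : IsSemialgebraicFunOn ℚ P b)
    {r : ℚ} (hr : (-1 : ℝ) < r)
    (hP : ∀ w ∈ P, 0 ≤ α w ∧ 2 * α w < b w ∧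
      I w = ∫⁻ s in soloInformedEIoo (α w : EReal) (b w : EReal), ENNReal.ofReal (s ^ (r : ℝ))) :
    IsSemialgebraic ℚ {t : Fin k → ℝ | ∫⁻ x, P.indicator H₀ (Fin.append t x) < ∞} := by
  have hbpos : ∀ w ∈ P, 0 < b w := fun w hw => by
    obtain ⟨h0, h2, -⟩ := hP w hw
    linarith
  have hS : IsSemialgebraicFunOn ℚ P (fun w => b w ^ ((r : ℚ) : ℝ) * b w) :=
    (IsSemialgebraicFunOn.mul_holds (hb.rpow_ratCast h.sa_P hbpos r) hb).congr fun _ _ => rfl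
  have hr1 : (0 : ℝ) < r + 1 := by linarith
  refine soloInformed_locus_surrogate ihI h hS
    (fun w hw => mul_nonneg (rpow_nonneg (hbpos w hw).le _) (hbpos w hw).le)
    (T := 1 / ((r : ℝ) + 1)) (L := (2 : ℝ) ^ (-|(r : ℝ)|) * ((2 : ℝ) ^ (-(r : ℝ)) / 2))
    (by positivity) (by positivity) (fun w hw => ?_) (fun w hw => ?_)
  · obtain ⟨h0, h2, hI⟩ := hP w hw
    rw [hI, show 1 / ((r : ℝ) + 1) * (b w ^ ((r : ℚ) : ℝ) * b w) =
      b w ^ ((r : ℚ) : ℝ) * b w / ((r : ℝ) + 1) by ring]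
    exact soloInformed_Irp_pos_upper hr h0 (hbpos w hw)
  · obtain ⟨h0, h2, hI⟩ := hP w hw
    rw [hI]
    exact soloInformed_Irp_pos_lower (r : ℝ) h2.le (hbpos w hw)

/-- FAR piece `{0 < α, 2α ≤ β}` (`β = b` or `β = ⊤`) for `r < -1`: surrogate `S = α^r α`. -/
theorem soloInformed_locus_far_neg (ihI : SoloInformedFinLocusAt k m)
    (h : SoloInformedLocusHyp P a H₀ I c) (hα : IsSemialgebraicFunOn ℚ P α)
    {r : ℚ} (hr : (r : ℝ) < -1) (β : (Fin (k + m) → ℝ) → EReal)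
    (hP : ∀ w ∈ P, 0 < α w ∧ ((2 * α w : ℝ) : EReal) ≤ β w ∧
      I w = ∫⁻ s in soloInformedEIoo (α w : EReal) (β w), ENNReal.ofReal (s ^ (r : ℝ))) :
    IsSemialgebraic ℚ {t : Fin k → ℝ | ∫⁻ x, P.indicator H₀ (Fin.append t x) < ∞} := by
  have hS : IsSemialgebraicFunOn ℚ P (fun w => α w ^ ((r : ℚ) : ℝ) * α w) :=
    (IsSemialgebraicFunOn.mul_holds (hα.rpow_ratCast h.sa_P (fun w hw => (hP w hw).1) r)
      hα).congr fun _ _ => rfl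
  have hr1 : (0 : ℝ) < -((r : ℝ) + 1) := by linarith
  refine soloInformed_locus_surrogate ihI h hS
    (fun w hw => mul_nonneg (rpow_nonneg (hP w hw).1.le _) (hP w hw).1.le)
    (T := 1 / -((r : ℝ) + 1)) (L := (2 : ℝ) ^ (r : ℝ)) (by positivity) (by positivity)
    (fun w hw => ?_) (fun w hw => ?_)
  · obtain ⟨h0, -, hI⟩ := hP w hw
    rw [hI, show 1 / -((r : ℝ) + 1) * (α w ^ ((r : ℚ) : ℝ) * α w) =
      α w ^ ((r : ℚ) : ℝ) * α w / -((r : ℝ) + 1) by ring]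
    exact soloInformed_Irp_neg_upper hr h0 (β w)
  · obtain ⟨h0, h2, hI⟩ := hP w hw
    rw [hI]
    exact soloInformed_Irp_neg_lower hr h0 h2

/-- FAR piece `{0 < α, 2α < b}` for `r = -1`: the logarithmic piece with `q = b / α`. -/
theorem soloInformed_locus_far_inv (ihI : SoloInformedFinLocusAt k m)
    (ihT : SoloInformedLogRoomAt k m)
    (h : SoloInformedLocusHyp P a H₀ I c) (hα : IsSemialgebraicFunOn ℚ P α)
    (hb : IsSemialgebraicFunOn ℚ P b) {r : ℚ} (hr : (r : ℝ) = -1)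
    (hP : ∀ w ∈ P, 0 < α w ∧ 2 * α w < b w ∧
      I w = ∫⁻ s in soloInformedEIoo (α w : EReal) (b w : EReal), ENNReal.ofReal (s ^ (r : ℝ))) :
    IsSemialgebraic ℚ {t : Fin k → ℝ | ∫⁻ x, P.indicator H₀ (Fin.append t x) < ∞} := by
  have hq : IsSemialgebraicFunOn ℚ P (fun w => b w / α w) :=
    hb.div hα fun w hw => (hP w hw).1.ne'
  refine soloInformed_locus_log ihI ihT h hq (fun w hw => ?_) (fun w hw => ?_) (fun w hw => ?_)
  · obtain ⟨h0, h2, -⟩ := hP w hw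
    rw [one_le_div h0]
    linarith
  · obtain ⟨h0, h2, hI⟩ := hP w hw
    rw [hI, hr]
    exact soloInformed_Irp_inv_upper h0 (by linarith)
  · obtain ⟨h0, h2, hI⟩ := hP w hw
    rw [hI, hr]
    exact soloInformed_Irp_inv_lower h0 (EReal.coe_le_coe_iff.mpr h2.le)

/-- Null piece `{α = 0 < β}` for `r ≤ -1`. -/
theorem soloInformed_locus_far_zero (h : SoloInformedLocusHyp P a H₀ I c)
    {r : ℚ} (hr : (r : ℝ) ≤ -1) (β : (Fin (k + m) → ℝ) → EReal)
    (hP : ∀ w ∈ P, α w = 0 ∧ (0 : EReal) < β w ∧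
      I w = ∫⁻ s in soloInformedEIoo (α w : EReal) (β w), ENNReal.ofReal (s ^ (r : ℝ))) :
    IsSemialgebraic ℚ {t : Fin k → ℝ | ∫⁻ x, P.indicator H₀ (Fin.append t x) < ∞} := by
  refine soloInformed_locus_null h (fun w hw => ?_)
  obtain ⟨h0, hβ, hI⟩ := hP w hw
  rw [hI, h0]
  exact soloInformed_Irp_zero_eq_top hr hβ

/-! ### The two sides -/

/-- **Half-line side** (`β = ⊤`): the locus over `P` is `ℚ`-semialgebraic. -/
theorem soloInformed_locus_side_top (ihI : SoloInformedFinLocusAt k m)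
    (h : SoloInformedLocusHyp P a H₀ I c) (hα : IsSemialgebraicFunOn ℚ P α) (r : ℚ)
    (hP : ∀ w ∈ P, 0 ≤ α w ∧
      I w = ∫⁻ s in soloInformedEIoo (α w : EReal) ⊤, ENNReal.ofReal (s ^ (r : ℝ))) :
    IsSemialgebraic ℚ {t : Fin k → ℝ | ∫⁻ x, P.indicator H₀ (Fin.append t x) < ∞} := by
  rcases lt_or_ge (r : ℝ) (-1) with hr | hr
  swap
  · refine soloInformed_locus_null h (fun w hw => ?_)
    obtain ⟨h0, hI⟩ := hP w hw
    rw [hI]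
    exact soloInformed_Irp_top_eq_top_of_le hr h0
  · have hfar : IsSemialgebraic ℚ {w | w ∈ P ∧ (-α) w < 0} := hα.neg.isSemialgebraic_sep_neg
    have hnull : IsSemialgebraic ℚ {w | w ∈ P ∧ 0 ≤ (-α) w} := hα.neg.isSemialgebraic_sep_nonneg
    refine soloInformed_locus_of_cover (B := P)
      (fun bb : Bool => cond bb {w | w ∈ P ∧ (-α) w < 0} {w | w ∈ P ∧ 0 ≤ (-α) w})
      (by rintro (_ | _) <;> exact fun w hw => hw.1)
      (soloInformed_measurableSet_cond hfar hnull) h.meas_H₀ (fun w hw => Or.inr ?_) ?_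
    · rcases lt_or_ge ((-α) w) 0 with hlt | hge
      · exact ⟨true, hw, hlt⟩
      · exact ⟨false, hw, hge⟩
    · rintro (_ | _)
      · refine soloInformed_locus_far_zero (α := α) (h.mono (fun w hw => hw.1) hnull) hr.le
          (fun _ => ⊤) (fun w hw => ?_)
        obtain ⟨h0, hI⟩ := hP w hw.1
        have h1 : 0 ≤ -α w := hw.2
        exact ⟨by linarith, EReal.zero_lt_top, hI⟩
      · refine soloInformed_locus_far_neg ihI (h.mono (fun w hw => hw.1) hfar)
          (hα.mono (fun w hw => hw.1) hfar) hr (fun _ => ⊤) (fun w hw => ?_)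
        obtain ⟨-, hI⟩ := hP w hw.1
        have h1 : -α w < 0 := hw.2
        exact ⟨by linarith, le_top, hI⟩

/-- **Bounded side** (`β = b` finite; empty fibres where `b ≤ α` carry no mass): the locus over
`P` is `ℚ`-semialgebraic. -/
theorem soloInformed_locus_side_fin (ihI : SoloInformedFinLocusAt k m)
    (ihT : SoloInformedLogRoomAt k m)
    (h : SoloInformedLocusHyp P a H₀ I c) (hα : IsSemialgebraicFunOn ℚ P α)
    (hb : IsSemialgebraicFunOn ℚ P b) (r : ℚ)
    (hP : ∀ w ∈ P, 0 ≤ α w ∧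
      (α w < b w → I w = ∫⁻ s in soloInformedEIoo (α w : EReal) (b w : EReal),
        ENNReal.ofReal (s ^ (r : ℝ))) ∧ (b w ≤ α w → H₀ w = 0)) :
    IsSemialgebraic ℚ {t : Fin k → ℝ | ∫⁻ x, P.indicator H₀ (Fin.append t x) < ∞} := by
  -- the pieces NEAR and FAR
  have hnear : IsSemialgebraic ℚ ({w | w ∈ P ∧ (-α) w < 0} ∩ ({w | w ∈ P ∧ (α - b) w < 0} ∩
      {w | w ∈ P ∧ 0 ≤ (α + α - b) w})) :=
    hα.neg.isSemialgebraic_sep_neg.inter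
      ((IsSemialgebraicFunOn.sub_holds hα hb).isSemialgebraic_sep_neg.inter
        (IsSemialgebraicFunOn.sub_holds (IsSemialgebraicFunOn.add_holds hα hα)
          hb).isSemialgebraic_sep_nonneg)
  have hfar : IsSemialgebraic ℚ {w | w ∈ P ∧ (α + α - b) w < 0} :=
    (IsSemialgebraicFunOn.sub_holds (IsSemialgebraicFunOn.add_holds hα hα) hb).isSemialgebraic_sep_neg
  refine soloInformed_locus_of_cover (B := P)
    (fun bb : Bool => cond bb ({w | w ∈ P ∧ (-α) w < 0} ∩ ({w | w ∈ P ∧ (α - b) w < 0} ∩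
      {w | w ∈ P ∧ 0 ≤ (α + α - b) w})) {w | w ∈ P ∧ (α + α - b) w < 0})
    (by rintro (_ | _) w hw; exacts [hw.1, hw.1.1])
    (soloInformed_measurableSet_cond hnear hfar) h.meas_H₀ (fun w hw => ?_) ?_
  · -- cover
    obtain ⟨h0, -, hI2⟩ := hP w hw
    by_cases hba : b w ≤ α w
    · exact Or.inl (hI2 hba)
    · rw [not_le] at hba
      refine Or.inr ?_
      rcases lt_or_ge (α w + α w - b w) 0 with hlt | hge
      · exact ⟨false, hw, by simpa only [Pi.sub_apply, Pi.add_apply] using hlt⟩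
      · have hαpos : 0 < α w := by
          rcases h0.lt_or_eq with h | h
          · exact h
          · exfalso; rw [← h] at hge hba; linarith
        refine ⟨true, ⟨hw, ?_⟩, ⟨hw, ?_⟩, ⟨hw, ?_⟩⟩
        · show -α w < 0
          linarith
        · show α w - b w < 0
          linarith
        · simpa only [Pi.sub_apply, Pi.add_apply] using hge
  · rintro (_ | _)
    · -- FAR
      have hF : ∀ w ∈ {w | w ∈ P ∧ (α + α - b) w < 0}, 0 ≤ α w ∧ 2 * α w < b w ∧
          I w = ∫⁻ s in soloInformedEIoo (α w : EReal) (b w : EReal),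
            ENNReal.ofReal (s ^ (r : ℝ)) := fun w hw => by
        obtain ⟨h0, hI1, -⟩ := hP w hw.1
        have h2 : α w + α w - b w < 0 := by simpa only [Pi.sub_apply, Pi.add_apply] using hw.2
        exact ⟨h0, by linarith, hI1 (by linarith)⟩
      have h' := h.mono (fun w hw => hw.1) hfar
      have hα' := hα.mono (fun w hw => hw.1) hfar
      have hb' := hb.mono (fun w hw => hw.1) hfar
      rcases lt_or_ge (-1 : ℝ) r with hr | hr
      · exact soloInformed_locus_far_pos ihI h' hb' hr hF
      · -- `r ≤ -1`: split by the sign of `α`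
        set F := {w | w ∈ P ∧ (α + α - b) w < 0} with hFdef
        have hFp : IsSemialgebraic ℚ {w | w ∈ F ∧ (-α) w < 0} := hα'.neg.isSemialgebraic_sep_neg
        have hFz : IsSemialgebraic ℚ {w | w ∈ F ∧ 0 ≤ (-α) w} :=
          hα'.neg.isSemialgebraic_sep_nonneg
        refine soloInformed_locus_of_cover (B := F)
          (fun bb : Bool => cond bb {w | w ∈ F ∧ (-α) w < 0} {w | w ∈ F ∧ 0 ≤ (-α) w})
          (by rintro (_ | _) <;> exact fun w hw => hw.1)
          (soloInformed_measurableSet_cond hFp hFz) h.meas_H₀ (fun w hw => Or.inr ?_) ?_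
        · rcases lt_or_ge ((-α) w) 0 with hlt | hge
          · exact ⟨true, hw, hlt⟩
          · exact ⟨false, hw, hge⟩
        · rintro (_ | _)
          · refine soloInformed_locus_far_zero (α := α) (h'.mono (fun w hw => hw.1) hFz) hr
              (fun w => (b w : EReal)) (fun w hw => ?_)
            obtain ⟨h0, h2, hI⟩ := hF w hw.1
            have h1 : 0 ≤ -α w := hw.2
            have hα0 : α w = 0 := by linarith
            exact ⟨hα0, by rw [hα0] at h2; exact_mod_cast (by linarith : 0 < b w), hI⟩
          · have hpos : ∀ w ∈ {w | w ∈ F ∧ (-α) w < 0}, 0 < α w := fun w hw => by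
              have h1 : -α w < 0 := hw.2
              linarith
            rcases hr.lt_or_eq with hr' | hr'
            · refine soloInformed_locus_far_neg ihI (h'.mono (fun w hw => hw.1) hFp)
                (hα'.mono (fun w hw => hw.1) hFp) hr' (fun w => (b w : EReal)) (fun w hw => ?_)
              obtain ⟨-, h2, hI⟩ := hF w hw.1
              exact ⟨hpos w hw, EReal.coe_le_coe_iff.mpr h2.le, hI⟩
            · exact soloInformed_locus_far_inv ihI ihT (h'.mono (fun w hw => hw.1) hFp)
                (hα'.mono (fun w hw => hw.1) hFp) (hb'.mono (fun w hw => hw.1) hFp) hr'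
                (fun w hw => by
                  obtain ⟨-, h2, hI⟩ := hF w hw.1
                  exact ⟨hpos w hw, h2, hI⟩)
    · -- NEAR
      refine soloInformed_locus_near ihI (h.mono (fun w hw => hw.1.1) hnear)
        (hα.mono (fun w hw => hw.1.1) hnear) (hb.mono (fun w hw => hw.1.1) hnear) r
        (fun w hw => ?_)
      obtain ⟨⟨hwP, h1⟩, ⟨-, h2⟩, ⟨-, h3⟩⟩ := hw
      have h1' : -α w < 0 := h1
      have h2' : α w - b w < 0 := h2
      have h3' : 0 ≤ α w + α w - b w := by simpa only [Pi.sub_apply, Pi.add_apply] using h3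
      obtain ⟨-, hI1, -⟩ := hP w hwP
      exact ⟨by linarith, by linarith, by linarith, hI1 (by linarith)⟩

end Summit.KontsevichZagierPeriods.KontsevichZagierPeriods.Theorems
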